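import Literature.NumberTheory.Transcendental.KZProductIdeal
import Literature.NumberTheory.Transcendental.KZLogCalculusProofs
import Literature.NumberTheory.Transcendental.KZMellinFibres
import Literature.NumberTheory.Transcendental.KZSemiCanonicalReductionHolds
import Literature.NumberTheory.Transcendental.KZMonomialCompression

/-!
# `NormalFormPrinciple` (stmt-KontsevichZagierPeriods-3869), line `SketchIdeator1` ("π buys geometry") —
# powers of `[π]`, finite integrand sums, and bounded volumes inside the open unit box

First support file of the lead's stub `stub_volumePiBox` of the crux skeleton
(`Cruxes/NormalFormPrinciple/Lines/SketchIdeator1.lean`), proving the registered sub-goal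
`exists_unitBox_model`: a bounded volume `[A, 1]` differs by KZ relations from a representation
inside the OPEN unit box `(0,1)ᵈ` with a constant integrand `Tᵈ` — translation by an integer
vector (`KZ.exists_translate_box`, Viu-Sos 2021 §4.1), the linear substitution `y = x/T` (rule 2),
`KZ.of_sub_of_mem_changeOfVariablesRel_linear`), and dropping the null faces `yᵢ = 0` (rule 1a)).
Alongside: the left-nested powers `[π]^k · c = (fun x => of piRep * x)^[k] c` of
`KZ.PiLocalKernel` are additive, pass to congruences (`KZ.piRep_mul_iterate_mem_relations`),
multiply values by `π^k` (`KZ.eval_piRep_mul`) and are peeled by `KZ.PiCancellation`; iterated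
integrand additivity over a finite family (rule 1b)); the degenerate null-domain case.
Pure proof file (theorems only). Sources: M. Kontsevich, D. Zagier, *Periods* (2001), §1.2;
J. Viu-Sos, *A semi-canonical reduction for periods of Kontsevich–Zagier*, IJNT (2021), §4.1.
-/

noncomputable section

open MeasureTheory Set
open Literature.NumberTheory.Transcendental Literature.NumberTheory.Transcendental.KZ
open Literature.ModelTheory.ExponentialFields (IsSemialgebraic)

namespace Summit.KontsevichZagierPeriods.HurwitzMicroSectors.NormalFormPrinciple.PiBox

variable {n m : ℕ}

/-! ## Powers of `[π]` -/

/-- `[π]·` is additive: `[π]·(c − c') = [π]·c − [π]·c'`. [folklore] -/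
theorem piMul_sub (c c' : FormalRep) : of piRep * (c - c') = of piRep * c - of piRep * c' :=
  mul_sub _ _ _

/-- `[π]^k·` is additive. [folklore] -/
theorem piPow_sub (k : ℕ) (c c' : FormalRep) : (fun x => of piRep * x)^[k] (c - c') = (fun x => of piRep * x)^[k] c - (fun x => of piRep * x)^[k] c' := by
  induction k generalizing c c' with
  | zero => rfl
  | succ k ih =>
    simp only [Function.iterate_succ_apply'] at ih ⊢
    rw [ih, piMul_sub]

/-- Congruences pass under `[π]^k·` (`relations` is a left ideal:
`KZ.piRep_mul_iterate_mem_relations`). [folklore] -/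
theorem piPow_congr (k : ℕ) {c c' : FormalRep} (h : c - c' ∈ relations) :
    (fun x => of piRep * x)^[k] c - (fun x => of piRep * x)^[k] c' ∈ relations := by
  have := piRep_mul_iterate_mem_relations k h
  rwa [piPow_sub] at this

/-- `[π]^(j+k)· = [π]^j·[π]^k·`. [folklore] -/
theorem piPow_add (j k : ℕ) (c : FormalRep) : (fun x => of piRep * x)^[(j + k)] c = (fun x => of piRep * x)^[j] ((fun x => of piRep * x)^[k] c) :=
  Function.iterate_add_apply _ _ _ _

/-- Soundness under powers of `[π]`: `eval ([π]^k·c) = π^k · eval c`. [folklore] -/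
theorem eval_piPow (k : ℕ) (c : FormalRep) : eval ((fun x => of piRep * x)^[k] c) = Real.pi ^ k * eval c := by
  induction k with
  | zero => simp
  | succ k ih =>
    simp only [Function.iterate_succ_apply'] at ih ⊢
    rw [eval_piRep_mul, ih, pow_succ]
    ring

/-- `PiCancellation` peels a power of `[π]`. [folklore] -/
theorem mem_of_piPow_mem (hpc : PiCancellation) (k : ℕ) {c : FormalRep} (h : (fun x => of piRep * x)^[k] c ∈ relations) :
    c ∈ relations := by
  induction k with
  | zero => exact h
  | succ k ih =>
    apply ih
    simp only [Function.iterate_succ_apply'] at h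
    exact hpc _ h

/-- `[π]^k·` is additive. [folklore] -/
theorem piPow_add_distrib (k : ℕ) (c c' : FormalRep) : (fun x => of piRep * x)^[k] (c + c') = (fun x => of piRep * x)^[k] c + (fun x => of piRep * x)^[k] c' := by
  induction k generalizing c c' with
  | zero => rfl
  | succ k ih =>
    simp only [Function.iterate_succ_apply'] at ih ⊢
    rw [ih, mul_add]

/-- `[π]^k · 0 = 0`. [folklore] -/
theorem piPow_zero_right (k : ℕ) : (fun x => of piRep * x)^[k] (0 : FormalRep) = 0 := by
  induction k with
  | zero => rfl
  | succ k ih => simp only [Function.iterate_succ_apply'] at ih ⊢; rw [ih, mul_zero]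

/-- `[π]^k·` commutes with finite sums. [folklore] -/
theorem piPow_sum {ι : Type*} (k : ℕ) (s : Finset ι) (c : ι → FormalRep) :
    (fun x => of piRep * x)^[k] (∑ i ∈ s, c i) = ∑ i ∈ s, (fun x => of piRep * x)^[k] (c i) := by
  classical
  induction s using Finset.induction_on with
  | empty => simp [piPow_zero_right]
  | insert a s ha ih => rw [Finset.sum_insert ha, Finset.sum_insert ha, piPow_add_distrib, ih]

/-! ## Finite sums of integrands; the degenerate case -/

/-- **Summing integrands over a finite family** (iterated rule 1b)): representations `R i`
(`i ∈ s`) on a common domain `W` and a representation `M` on `W` whose integrand is the sum of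
theirs satisfy `[M] − Σᵢ [R i] ∈ relations`. [cite: KontsevichZagier2001, §1.2] -/
theorem of_sub_sum_of_integrand {N : ℕ} {ι : Type*} (s : Finset ι) :
    ∀ (M : IntegralRep N) (R : ι → IntegralRep N), (∀ i ∈ s, (R i).domain = M.domain) →
      EqOn M.integrand (fun x => ∑ i ∈ s, (R i).integrand x) M.domain →
      of M - ∑ i ∈ s, of (R i) ∈ relations := by
  classical
  induction s using Finset.induction_on with
  | empty =>
    intro M R _ h
    simp only [Finset.sum_empty, sub_zero]
    exact of_mem_relations_of_eqOn_zero M fun x hx => by simpa using h hx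
  | insert a s ha ih =>
    intro M R hd h
    let M' : IntegralRep N :=
      { domain := M.domain
        integrand := fun x => ∑ i ∈ s, (R i).integrand x
        isSemialgebraic_domain := M.isSemialgebraic_domain
        isSemialgebraicFunOn_integrand := isSemialgebraicFunOn_finset_sum _ M.isSemialgebraic_domain
          fun i hi => hd i (Finset.mem_insert_of_mem hi) ▸ (R i).isSemialgebraicFunOn_integrand
        integrableOn := by
          have : IntegrableOn (fun x => ∑ i ∈ s, (R i).integrand x) M.domain :=
            integrable_finsetSum _ fun i hi =>
              hd i (Finset.mem_insert_of_mem hi) ▸ (R i).integrableOn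
          exact this }
    have h1 : of M - of (R a) - of M' ∈ relations :=
      integrandAddRel_subset_relations ⟨N, M, R a, M', hd a (Finset.mem_insert_self a s), rfl,
        fun x hx => by
          show M.integrand x = (R a).integrand x + M'.integrand x
          rw [h hx]
          simp only [Finset.sum_insert ha]
          rfl, rfl⟩
    have h2 : of M' - ∑ i ∈ s, of (R i) ∈ relations :=
      ih M' R (fun i hi => hd i (Finset.mem_insert_of_mem hi)) fun x _ => rfl
    rw [Finset.sum_insert ha]
    have : of M - (of (R a) + ∑ i ∈ s, of (R i)) = (of M - of (R a) - of M') +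
        (of M' - ∑ i ∈ s, of (R i)) := by abel
    rw [this]
    exact relations.add_mem h1 h2

/-- The zero representation on the open unit box is box-rational, and a representation with null
domain reduces to it (degenerate case of the engine). [folklore] -/
theorem exists_boxRat_of_null {d : ℕ} (A : IntegralRep d) (hA : volume A.domain = 0) :
    ∃ (k m : ℕ) (N : IntegralRep m), N.domain = {x | ∀ i, x i ∈ Set.Ioo (0:ℝ) 1} ∧ N.IsRational ∧
      (fun x => of piRep * x)^[k] (of A) - of N ∈ relations := by
  obtain ⟨Z, hZd, hZi⟩ := exists_zeroRep (isSemialgebraic_box d)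
  refine ⟨0, d, Z, hZd, ⟨0, 1, fun x _ => by simp, fun x _ => by simp [hZi]⟩, ?_⟩
  have h1 : of A ∈ relations := of_mem_relations_of_volume_eq_zero A hA
  have h2 : of Z ∈ relations := of_mem_relations_of_eqOn_zero Z (by simp [hZi, EqOn])
  simpa using relations.sub_mem h1 h2

/-! ## Bounded volumes: translation and scaling into the open unit box -/

/-- **Scaling into the unit box** (rule 2) with the linear map `y = x/T`): a representation with
integrand `1` and domain inside `[0, T)ᵈ` (`T ≥ 1` an integer) differs by a relation from a
representation with domain inside the open unit box `(0,1)ᵈ` and constant integrand `Tᵈ` (the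
closed faces `yᵢ = 0` are null, rule 1a)). [cite: KontsevichZagier2001, §1.2] -/
theorem exists_scale_unitBox {d : ℕ} (r : IntegralRep d) (T : ℕ) (hT : 1 ≤ T)
    (h1 : ∀ x ∈ r.domain, r.integrand x = 1)
    (hbox : ∀ x ∈ r.domain, ∀ i, 0 ≤ x i ∧ x i < T) :
    ∃ A : IntegralRep d, A.domain ⊆ {y | ∀ i, y i ∈ Set.Ioo (0:ℝ) 1} ∧
      (A.integrand = fun _ => (T : ℝ) ^ d) ∧ of r - of A ∈ relations := by
  have hTpos : (0 : ℝ) < T := by exact_mod_cast hT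
  have hTne : (T : ℝ) ≠ 0 := hTpos.ne'
  -- the linear substitution `L y = y / T` wait: we scale `x ↦ x / T`
  let L : (Fin d → ℝ) →L[ℝ] (Fin d → ℝ) := (T : ℝ)⁻¹ • ContinuousLinearMap.id ℝ _
  have hL : ∀ x, L x = (T : ℝ)⁻¹ • x := fun x => rfl
  have hdet : L.det = ((T : ℝ)⁻¹) ^ d := by
    show LinearMap.det ((L : (Fin d → ℝ) →L[ℝ] (Fin d → ℝ)) : (Fin d → ℝ) →ₗ[ℝ] (Fin d → ℝ)) = _
    have : ((L : (Fin d → ℝ) →L[ℝ] (Fin d → ℝ)) : (Fin d → ℝ) →ₗ[ℝ] (Fin d → ℝ)) =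
        (T : ℝ)⁻¹ • LinearMap.id := by
      ext x i; simp [hL]
    rw [this, LinearMap.det_smul, LinearMap.det_id, mul_one, Module.finrank_fin_fun]
  -- the scaled domain
  set D : Set (Fin d → ℝ) := (fun y : Fin d → ℝ => (T : ℝ) • y) ⁻¹' r.domain with hD
  have hDeq : D = L '' r.domain := by
    ext y
    simp only [hD, mem_preimage, mem_image, hL]
    constructor
    · intro hy
      exact ⟨(T : ℝ) • y, hy, by rw [smul_smul, inv_mul_cancel₀ hTne, one_smul]⟩
    · rintro ⟨x, hx, rfl⟩
      rwa [smul_smul, mul_inv_cancel₀ hTne, one_smul]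
  have hDsa : IsSemialgebraic ℚ D := by
    have := r.isSemialgebraic_domain.preimage_aeval
      (fun j : Fin d => (MvPolynomial.C (T : ℚ) * MvPolynomial.X j : MvPolynomial (Fin d) ℚ))
    convert this using 1
    ext y
    simp only [hD, mem_preimage]
    congr! 1
    ext j
    simp
  have hDsub : D ⊆ {y | ∀ i, y i ∈ Set.Ico (0:ℝ) 1} := by
    intro y hy i
    have h := hbox _ hy i
    simp only [Pi.smul_apply, smul_eq_mul] at h
    constructor
    · nlinarith [h.1]
    · nlinarith [h.2]
  have hDvol : volume D < ⊤ := by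
    refine (measure_mono (hDsub.trans ?_)).trans_lt
      ((Metric.isBounded_Icc (0 : Fin d → ℝ) 1).measure_lt_top)
    intro y hy
    exact ⟨fun i => (hy i).1, fun i => (hy i).2.le⟩
  let B : IntegralRep d :=
    { domain := D
      integrand := fun _ => (T : ℝ) ^ d
      isSemialgebraic_domain := hDsa
      isSemialgebraicFunOn_integrand := by
        simpa using isSemialgebraicFunOn_ratCast hDsa ((T : ℚ) ^ d)
      integrableOn := integrableOn_const (hs := hDvol.ne) }
  have hrB : of r - of B ∈ relations := by
    refine changeOfVariablesRel_subset_relations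
      (of_sub_of_mem_changeOfVariablesRel_linear r B L ?_ ?_ hDeq fun x hx => ?_)
    · refine (isSemialgebraicMapOn_aeval r.isSemialgebraic_domain
        (fun j : Fin d => (MvPolynomial.C ((T : ℚ)⁻¹) * MvPolynomial.X j :
          MvPolynomial (Fin d) ℚ))).congr fun x _ => ?_
      ext j
      simp [hL]
    · intro x _ y _ hxy
      have := congrArg (fun z => (T : ℝ) • z) hxy
      simpa [hL, smul_smul, mul_inv_cancel₀ hTne] using this
    · rw [h1 x hx, hdet, abs_of_pos (by positivity)]
      show (1 : ℝ) = (T : ℝ) ^ d * ((T : ℝ)⁻¹) ^ d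
      rw [← mul_pow, mul_inv_cancel₀ hTne, one_pow]
  -- drop the null faces `yᵢ = 0`
  have hUsa : IsSemialgebraic ℚ (D ∩ {y | ∀ i, y i ∈ Set.Ioo (0:ℝ) 1}) :=
    hDsa.inter (isSemialgebraic_box d)
  have hnull : volume (B.domain \ (D ∩ {y | ∀ i, y i ∈ Set.Ioo (0:ℝ) 1})) = 0 := by
    have hsub : B.domain \ (D ∩ {y | ∀ i, y i ∈ Set.Ioo (0:ℝ) 1}) ⊆
        ⋃ i : Fin d, {y : Fin d → ℝ | MvPolynomial.aeval y (MvPolynomial.X (R := ℚ) i) = 0} := by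
      intro y hy
      have hyD : y ∈ D := hy.1
      have hnot : ¬ ∀ i, y i ∈ Set.Ioo (0:ℝ) 1 := fun h => hy.2 ⟨hyD, h⟩
      simp only [not_forall] at hnot
      obtain ⟨i, hi⟩ := hnot
      refine mem_iUnion.2 ⟨i, ?_⟩
      have h0 := hDsub hyD i
      simp only [mem_setOf_eq, MvPolynomial.aeval_X]
      by_contra hne
      exact hi ⟨lt_of_le_of_ne h0.1 (Ne.symm hne), h0.2⟩
    refine measure_mono_null hsub ((measure_iUnion_null_iff).2 fun i => ?_)
    exact volume_setOf_aeval_eq_zero _ (by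
      rw [MvPolynomial.map_X]; exact MvPolynomial.X_ne_zero _)
  refine ⟨B.restrict _ hUsa inter_subset_left, fun y hy => hy.2, rfl, ?_⟩
  have := B.of_sub_of_restrict_mem_relations hUsa inter_subset_left hnull
  have e : of r - of (B.restrict _ hUsa inter_subset_left) = (of r - of B) +
      (of B - of (B.restrict _ hUsa inter_subset_left)) := by abel
  rw [e]
  exact relations.add_mem hrB this

/-- **Bounded volumes into the unit box**: a representation with integrand `1` on a bounded domain
differs by a relation from one with domain inside the open unit box and a constant natural-number
integrand (translation by an integer vector, then scaling). [cite: ViuSos2021, §4.1] -/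
theorem exists_unitBox_model {d : ℕ} (A : IntegralRep d) (hb : Bornology.IsBounded A.domain)
    (h1 : ∀ z ∈ A.domain, A.integrand z = 1) :
    ∃ (T : ℕ) (B : IntegralRep d), 1 ≤ T ∧ B.domain ⊆ {y | ∀ i, y i ∈ Set.Ioo (0:ℝ) 1} ∧
      (B.integrand = fun _ => (T : ℝ) ^ d) ∧ of A - of B ∈ relations := by
  obtain ⟨C, hC⟩ := (Metric.isBounded_iff_subset_closedBall 0).1 hb
  have hC' : ∀ x ∈ A.domain, ‖x‖ ≤ C := fun x hx => by simpa using hC hx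
  obtain ⟨r', -, h1', hbox, -, hrel⟩ := exists_translate_box A h1 hC'
  obtain ⟨B, hBsub, hBi, hB⟩ := exists_scale_unitBox r' (2 * (⌈C⌉₊ + 1)) (by omega) h1'
    (fun x hx i => by exact_mod_cast hbox x hx i)
  refine ⟨2 * (⌈C⌉₊ + 1), B, by omega, hBsub, hBi, ?_⟩
  have e : of A - of B = (of A - of r') + (of r' - of B) := by abel
  rw [e]
  exact relations.add_mem hrel hB
end Summit.KontsevichZagierPeriods.HurwitzMicroSectors.NormalFormPrinciple.PiBox
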